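import Literature.Analysis.FluidPDE.TaoAveraged
import Literature.Analysis.FluidPDE.TaoAveragedSobolev
import HarnessLib

/-!
# Tao's averaged Navier–Stokes blow-up: proved reductions between the two (deprecated) function-level forms of **ns.S17**

Companion ("Proofs" sibling) of `Literature/Analysis/FluidPDE/TaoAveraged.lean`, which renders
T. Tao, *Finite time blowup for an averaged three-dimensional Navier–Stokes equation*,
J. Amer. Math. Soc. 29 (2016), 601–674 (arXiv:1402.0290v3), Thm. 1.5, over the accepted
function-level prelude as two closed named facts:

* `tao_averaged_ns_blowup` — the main theorem in Tao's own form (a *symmetric* averaged Euler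
  bilinear operator with cancellation and a Schwartz divergence-free datum without global
  `H¹⁰_df` mild solution), and
* `exists_not_averagedNSGlobalRegularity` — "global regularity (`AveragedNSGlobalRegularity`, the
  analogue of Clay (A)) fails for some averaged Euler bilinear operator with cancellation".

**Both facts are deprecated (verdict clean-up, 2026-08-15): they are mis-stated** — see the source
notes below and the module docstring of `TaoAveraged.lean`; the printed theorem and its corollary
are `Literature.Analysis.FluidPDE.Tao2016.averagedNS_blowup` and
`Literature.Analysis.FluidPDE.Tao2016.exists_not_globalRegularity` (`TaoAveragedSobolev.lean`), related
by the proved `Tao2016.exists_not_globalRegularity_of_blowup`. The three theorems of this file are the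
elementary logic relating the two *deprecated* statements (the second is the first with the
symmetry clause dropped: `exists_not_averagedNSGlobalRegularity_of_blowup`,
`exists_not_averagedNSGlobalRegularity_iff`, `tao_averaged_ns_blowup.exists_datum`); they stay
correct and are kept under their names, themselves `@[deprecated]`, with `linter.deprecated`
silenced on exactly these three declarations (their statements mention the deprecated names by
design). Do not use them in new code: work with the `Tao2016` statements.

## Source notes (read at arXiv:1402.0290v3 = published version)

* The main theorem is **Thm. 1.5** of the published paper / arXiv v3 (it was Thm. 1.4 in arXiv
  v1–v2, the number quoted by the interim text of `TaoAveraged.lean`).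
* Tao's dilation (1.11) is `Dil_λ u (x) = λ^{3/2} u(λx)`: the exponent flagged "unverified" in the
  prelude is `3/2` at source. (Equation numbers of §1.1 as counted in arXiv v3: (1.9) the
  averaged equation, (1.10) the seminorms, (1.11) `Dil_λ`, (1.12)–(1.13) `B̃`, (1.15) mild
  solutions, (1.16) cancellation; the prelude's "(1.8)–(1.12)" predate this numbering.)
* Tao's "real Fourier multipliers of order 0" (the class `𝓜₀`, §1.1, p. 6) are *complex*
  symbols `m : ℝ³ → ℂ` with `m(−ξ) = conj (m ξ)`; the accepted `IsAveragedEulerBilinear` uses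
  real-valued symbols only, of which `multiplierApply` keeps the even part. The printed theorem
  over Tao's own class and `H¹⁰_df` solution concept is the tree's
  `Literature.Analysis.FluidPDE.Tao2016.averagedNS_blowup`, with corollary
  `Tao2016.exists_not_globalRegularity` — the corrected forms of `tao_averaged_ns_blowup` and
  `exists_not_averagedNSGlobalRegularity` (`TaoAveragedSobolev.lean`, whose module docstring
  lists the discrepancies; see also `Literature.Barriers.NavierStokesRegularity.TaoAveragedBlowup`,
  `scope_caveats` (vi)–(vii)). The present file only concerns the deprecated statements.
* **Parity obstruction** (why the deprecated facts are not even a re-representation away from the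
  source). Let `P u (x) := −u(−x)`. The accepted operations commute with `P` identically —
  `dilateField σ λ ∘ P = P ∘ dilateField σ λ`, `rotateField R ∘ P = P ∘ rotateField R` for every
  linear isometry `R`, `eulerBilinear (P u) (P v) = P (eulerBilinear u v)` (the Leray symbol is
  even; `fderiv` of `x ↦ −g(−x)` at `x` is `fderiv g (−x)`), and
  `multiplierApply m (P g) = P (multiplierApply (m ∘ Neg.neg) g)` — while on honest inputs
  (real `g ∈ L¹` with `m ĝ`, `m(−·) ĝ ∈ L¹`) one has
  `multiplierApply (m ∘ Neg.neg) g = multiplierApply m g`, both being `𝓕⁻(m_even ĝ)`. Hence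
  every `B̃` with `IsAveragedEulerBilinear B̃` satisfies `B̃(Pu, Pv) = P B̃(u, v)` on Schwartz
  divergence-free `u, v` (where the prelude's operators are honest). Tao's witness for Thm. 1.5
  is the cascade operator `C` of his §4, (4.1), built from real Schwartz `ψᵢ` with
  *real-valued* `ψ̂ᵢ` (§4, the paragraph before (4.1)), hence even `ψᵢ`, for which
  `⟨Pu, ψ⟩ = −⟨u, ψ⟩` and `P ψ = −ψ` give `C(Pu, Pv) = −P C(u, v)`. A nonzero bounded bilinear
  operator on `H¹⁰_df` cannot have both signs on the dense Schwartz divergence-free fields, so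
  `C` is not (the restriction of) any operator of the accepted class: the source's proof yields
  no witness for `tao_averaged_ns_blowup` / `exists_not_averagedNSGlobalRegularity`, whatever
  representation of `C` one tries (Tao's Rem. 4.3 variant with odd `ψᵢ` would remove this
  particular obstruction but is not what is proved, and his Thm. 3.2 would still have to be
  redone inside the even real symbol class).

## References

* T. Tao, J. Amer. Math. Soc. 29 (2016), 601–674 = arXiv:1402.0290v3: §1.1 (Conj. 1.2, the
  class `𝓜₀`, (1.9)–(1.16), Rem. 1.4, Thm. 1.5), §3.1, §4 ((4.1), Rem. 4.3). [Tao2016AveragedNS]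
-/

noncomputable section

open MeasureTheory Set Function Filter

namespace Literature.Analysis.FluidPDE

-- `linter.deprecated` is switched off for the next declaration only: hypothesis and conclusion are the two closed facts of
-- `TaoAveraged.lean`, deprecated on 2026-08-15 (mis-stated); this theorem is the logic between them and is deprecated with them.
set_option linter.deprecated false in
/-- **Deprecated** (2026-08-15) together with the two facts it relates; the printed counterpart is
`Tao2016.exists_not_globalRegularity_of_blowup` (`TaoAveragedSobolev.lean`). *Content (unchanged):*
`exists_not_averagedNSGlobalRegularity` is an immediate corollary of the blow-up fact
`tao_averaged_ns_blowup`: drop the symmetry clause and read "no global mild solution from the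
Schwartz divergence-free datum `u₀`" as the failure of `AveragedNSGlobalRegularity B` at `u₀`
(this is the interim proof preserved as a comment in `TaoAveraged.lean`, with the named fact an
explicit hypothesis). T. Tao, J. Amer. Math. Soc. 29 (2016), Thm. 1.5 (= arXiv:1402.0290v3,
Thm. 1.5) and the discussion preceding it in §1.1. [cite: Tao2016AveragedNS, §1.1 Thm. 1.5] -/
@[deprecated Literature.Analysis.FluidPDE.Tao2016.exists_not_globalRegularity_of_blowup
  (since := "2026-08-15")]
theorem exists_not_averagedNSGlobalRegularity_of_blowup (h : tao_averaged_ns_blowup) :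
    exists_not_averagedNSGlobalRegularity := by
  obtain ⟨B, hB, -, hC, u₀, hu₀, hdiv, hno⟩ := h
  exact ⟨B, hB, hC, fun hreg => hno (hreg u₀ hu₀ hdiv)⟩

-- `linter.deprecated` off for the next declaration only: it unfolds the deprecated closed fact
-- `exists_not_averagedNSGlobalRegularity` (mis-stated, 2026-08-15) and is deprecated with it.
set_option linter.deprecated false in
/-- **Deprecated** (2026-08-15) together with the fact it unfolds; use the `Tao2016` statements of
`TaoAveragedSobolev.lean`. *Content (unchanged):* failure of `AveragedNSGlobalRegularity B` means
precisely that some Schwartz divergence-free datum admits no global `H¹⁰_df` mild solution; hence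
`exists_not_averagedNSGlobalRegularity` is `tao_averaged_ns_blowup` without the symmetry clause
`B u v = B v u` (Tao 2016, §1.1: Conj. 1.2 and Thm. 1.5 are statements about individual data). [folklore] -/
@[deprecated "mis-stated closed fact unfolded; use Literature.Analysis.FluidPDE.Tao2016.exists_not_globalRegularity (TaoAveragedSobolev.lean)"
  (since := "2026-08-15")]
theorem exists_not_averagedNSGlobalRegularity_iff :
    exists_not_averagedNSGlobalRegularity ↔
      ∃ B : (EuclideanSpace ℝ (Fin 3) → EuclideanSpace ℝ (Fin 3)) →
          (EuclideanSpace ℝ (Fin 3) → EuclideanSpace ℝ (Fin 3)) →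
            EuclideanSpace ℝ (Fin 3) → EuclideanSpace ℝ (Fin 3),
        FluidPDE.IsAveragedEulerBilinear B ∧ FluidPDE.HasCancellation B ∧
          ∃ u₀ : EuclideanSpace ℝ (Fin 3) → EuclideanSpace ℝ (Fin 3),
            FluidPDE.IsSchwartzField u₀ ∧ VectorCalculus.IsDivFree u₀ ∧
              ¬ ∃ u : ℝ → EuclideanSpace ℝ (Fin 3) → EuclideanSpace ℝ (Fin 3),
                IsGlobalH10MildSolution B u₀ u := by
  simp only [exists_not_averagedNSGlobalRegularity, AveragedNSGlobalRegularity, not_forall,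
    exists_prop]

-- `linter.deprecated` off for the next declaration only: its hypothesis is the deprecated closed fact
-- `tao_averaged_ns_blowup` (mis-stated, 2026-08-15) and it is deprecated with it.
set_option linter.deprecated false in
/-- **Deprecated** (2026-08-15) together with its hypothesis; the printed theorem is
`Tao2016.averagedNS_blowup` (`TaoAveragedSobolev.lean`). *Content (unchanged):* Tao's symmetric form
`tao_averaged_ns_blowup` yields the right-hand side of `exists_not_averagedNSGlobalRegularity_iff`
(forget symmetry). [folklore] -/
@[deprecated "hypothesis is the mis-stated closed fact tao_averaged_ns_blowup; use Literature.Analysis.FluidPDE.Tao2016.averagedNS_blowup (TaoAveragedSobolev.lean)"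
  (since := "2026-08-15")]
theorem tao_averaged_ns_blowup.exists_datum (h : tao_averaged_ns_blowup) :
    ∃ B : (EuclideanSpace ℝ (Fin 3) → EuclideanSpace ℝ (Fin 3)) →
        (EuclideanSpace ℝ (Fin 3) → EuclideanSpace ℝ (Fin 3)) →
          EuclideanSpace ℝ (Fin 3) → EuclideanSpace ℝ (Fin 3),
      FluidPDE.IsAveragedEulerBilinear B ∧ FluidPDE.HasCancellation B ∧
        ∃ u₀ : EuclideanSpace ℝ (Fin 3) → EuclideanSpace ℝ (Fin 3),
          FluidPDE.IsSchwartzField u₀ ∧ VectorCalculus.IsDivFree u₀ ∧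
            ¬ ∃ u : ℝ → EuclideanSpace ℝ (Fin 3) → EuclideanSpace ℝ (Fin 3),
              IsGlobalH10MildSolution B u₀ u :=
  exists_not_averagedNSGlobalRegularity_iff.1 (exists_not_averagedNSGlobalRegularity_of_blowup h)

end Literature.Analysis.FluidPDE
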